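import Summits.BirchSwinnertonDyer.BirchSwinnertonDyer.Theses.UniversalToricDescent
import Summits.BirchSwinnertonDyer.BirchSwinnertonDyer.Theorems.UniversalToricDescentTwinAlgMuZeroAtThreeOfBetaRoadParam
import Summits.BirchSwinnertonDyer.BirchSwinnertonDyer.Theorems.UniversalToricDescentAcDualMuZeroCriterion
import Literature.NumberTheory.EllipticCurves.KatoFineSelmerDual
import HarnessLib

/-!
# Crux r205 `TwinAlgMuZeroAtThree` (stmt-BirchSwinnertonDyer-24737) — node `fine-selmer-cut` (crux-ideate g8, 2026-08-30)

**THE MOVE (the «Matar cut»).**  Line of record `beta-road` v19 closes the crux from K1‴ ∧ K2a‴ ∧ C₀′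
(`twinAlgMuZeroAtThree_of_betaRoadParamStubs`, p776836).  Its rank-2 stub K1‴
(`PrincipalHeegnerIndivisibleMultOfParamAtThree`: ONE layer-`k` Heegner norm point of `E′ = W′/K` is not `3`·(a point
fixed by the DECOMPOSITION group `Γ_k ∩ D_𝔭`) — a LOCAL residual non-triviality at the degree-one prime `𝔭 ∣ 3`) is
exactly Matar's Conjecture C(i) («`Γ·{Heegner points} ⊂ E(K_{∞,𝔭_∞})/p` is infinite») transported to `p = 3 ∥ N′`.
Matar proved, at a good ordinary prime `p ≥ 5` under his hypotheses (*), that C(i) is EQUIVALENT to the anticyclotomic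
Coates–Sujatha conjecture B: «the fine Selmer group `R_{p^∞}(E/K_∞^{ac})` is a cofinitely generated `ℤ_p`-module»
[cite: Matar2018, Thm. 3.3(a) = arXiv:1503.06463 p. 12–14], and the direction B ⟹ C(i) is a pure
KUMMER-THEORY argument: if every Heegner class is locally divisible by `p` at `𝔭_∞` (and, by the `τ`-symmetry of the
Heegner module, at `τ𝔭_∞`), the Kummer images of the locally-divisible Heegner points are FINE Selmer classes killed by `p`,
and GLOBAL indivisibility of the Heegner module (Cornut–Vatsal) makes them span an infinite `𝔽_p`-space — contradicting B.
This node CUTS K1‴ accordingly: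

  K1‴  ⟸  (G)‴ ∧ FINE‴      (`stub_fineCut`, the Matar cut ported to `3 ∥ N′`, bucket B)

* (G)‴ `GlobalHeegnerIndivisibleMultOfParamAtThree` — K1‴'s text with the decomposition group DELETED: one layer-`k`
  principal Heegner norm point `∑_{r∈R} r•x` is not `3`·(a `K_k`-rational point).  GLOBAL indivisibility.
  TAG: WEAKER than K1‴ (PROVED here: `global_of_principalHeegnerIndivisible`) · INSTRUMENTABLE per twin (reduce the
  layer point modulo one good prime of `K_k` and test `3`-divisibility in `E′(𝔽_q)`; no `3`-adic precision needed) ·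
  class-wide UNDECIDED/port (Cornut–Vatsal's mod-`p` non-triviality is printed for `p ∤ N d_K`; at `3 ∥ N′` the CM points
  of conductor `3^{k+1}` carry the canonical `Γ₀(3)`-structure) [cite: CornutVatsal2005, Thm. 1.10 (shape)]
  [cite: Matar2014, Thm. 1.2 (arXiv:1411.4685; `p ∤ N d_K`)].
* FINE‴ `FineSelmerThreeTorsionFiniteAtThree` — «`Sel₀(K_∞, E′[3^∞])[3]` is finite» for the fine (= everywhere strict)
  Selmer group `WeierstrassCurve.fineSelmerInfty` of the tree, binders copied from the crux (both buckets).
  TAG: WEAKER than the crux (PROVED here: `fine_of_crux`, through `fineSelmerInfty_le_selmerAc` — the fine group sits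
  inside Castella's `Sel_(∅ at 𝔭′, str at 𝔭′)`… precisely inside `selmerAc … 𝔭′ ∅` — and the route receptacle
  `finite_pTorsion_of_isTorsion_of_exists_generator`) · = anticyclotomic Coates–Sujatha Conjecture A/B at `p = 3`
  [cite: Matar2018, Conj. B (arXiv:1503.06463 p. 3)] [cite: CoatesSujatha2005, Conj. A] ·
  INSTRUMENTABLE per twin by TWO engines independent of Howard/Kolyvagin: (i) Wuthrich's Euler characteristic of the fine
  Selmer group over ANY `ℤ_p`-extension from LAYER-0 data — `y_K` non-torsion, `3 ∤ [E′(K) : ℤ y_K]`, `3 ∤ c_v`,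
  `3 ∤ #Ẽ′(k_v)` (`v ∣ 3`), a point of `E′₁(K_v)` with `ord_v log = 1` ⟹ `R(E′/K_∞)` cofinitely generated
  [cite: Matar2018, Thm. 4.1 (p. 15–17)] [cite: Wuthrich2007JAG, Thm. 6.1];
  (ii) the tree's class-group criterion `finite_fineSelmerInfty_of_equivariantHom_classGroup_layer_eq_zero`
  (`Literature/…/FineSelmerIsotypicClassGroupCriterionLayer.lean`) · class-wide IDEA-NEEDED (honest: given (G)‴ and
  Howard's divisibilities, FINE‴ ⟺ K1‴ — Matar's Thm. 3.3 — so the cut RELOCATES the research content of K1‴ into the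
  fine Selmer group, where `p`-adic heights / class groups / Kato-type arguments act, none of which is an anticyclotomic
  Euler-system argument at `p = 3`).
* `stub_fineCut` (G)‴ → FINE‴ → K1‴ — TAG: UNDECIDED · ATTACKABLE (port of [Matar2018, proof of Thm. 3.3(a)
  «backward implication», p. 12, and the `τ`-argument of part (b), p. 13–14] to `p = 3 ∥ N′`, très ramifié): ingredients
  `E′(K_{∞,w})[3] = 0` for `w ∣ 3` (Tate curve, très ramifié; audit g53), `E′(K_∞)[3] = 0` (`ρ̄₃` onto `GL₂(𝔽₃)`, whose
  abelianisation is `ℤ/2`, so the only quadratic subfield of `ℚ(E′[3])` is `ℚ(√−3) ≠ K` as `d_K` is odd),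
  `E′(K_{∞,v}) ⊗ ℚ₃/ℤ₃ = 0` for `v ∤ 3`, the two-term norm relations of bucket B (`a₃(E′) = ±1`, no `p`-old part:
  `N_{k′/k} = T^{3^{k′}−3^{k}}` in `𝔽₃[Γ_{k′}]`, so ONE globally indivisible layer-`k` point gives
  `dim_{𝔽₃} 𝔽₃[Γ_{k′}]·z̄_{k′} ≥ 3^{k′} − 3^{k} + 1 → ∞`), and `τ(y_β) = ε·σ·y_{−β} + torsion` (Gross) to pass local
  divisibility from `𝔭` to `𝔭′ = τ𝔭`.  Size L.  Leans on `UniversalToricDescentHeegnerClassKummerBridge`,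
  `UniversalToricDescentResidualNormSpan*`, `UniversalToricDescentOneLayerCriterion` (tree).
* K2a‴ (`KsTwinLambdaAdicAtThree`, item stmt-32864) and C₀′ (`TwinAlgMuZeroAtThreeGoodSSOfParam`) BY NAME, unchanged
  (tags as on line `beta-road`: UNDECIDED · ATTACKABLE).

**Composition** `TwinAlgMuZeroAtThree_of : (G)‴ → FINE‴ → CUT‴ → K2a‴ → C₀′ → crux` (CUT‴ := (G)‴ → FINE‴ → K1‴) — kernel-checked,
concludes the crux BY NAME through `twinAlgMuZeroAtThree_of_betaRoadParamStubs`; `sorry` ONLY inside the five `stub_*`.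
**Disproof used:** honours `twinAlgMuZeroAtThree_false_without_heegner` (the Heegner hypothesis is consumed by (G)‴ — the
Heegner points exist — and by the `τ`-symmetry inside `stub_fineCut`); no stub is an instance of a landed Negative lemma
(negatives 24881, 15532 concern the adjoint/BF lines).  Nothing here is asserted beyond the two PROVED comparison lemmas.
-/

noncomputable section

open scoped Classical NumberField

set_option linter.dupNamespace false
set_option autoImplicit false

namespace Summit.BirchSwinnertonDyer.BirchSwinnertonDyer.Cruxes.TwinAlgMuZeroAtThree.FineSelmerCut

open NumberField IsDedekindDomain Field WeierstrassCurve Finset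
open Literature.NumberTheory.EllipticCurves Literature.NumberTheory.EllipticCurves.IwasawaAlgebra
open Literature.NumberTheory.EllipticCurves.ZpExtension Literature.NumberTheory.EllipticCurves.GreenbergSelmer
open Summit.BirchSwinnertonDyer.Rank1Residual.X11b Summit.BirchSwinnertonDyer.Rank1Residual.X11b.AcSelmer
open Summit.BirchSwinnertonDyer.BirchSwinnertonDyer.Theorems
open Literature.NumberTheory.EllipticCurves.ModularForms (ModularParametrizationData heegnerPointComplexOfConductor)

/-! ## §1 The two new pieces (Props only; nothing asserted) -/

/-- **(G)‴ — GLOBAL indivisibility of one principal layer Heegner point (bucket B).**  Verbatim the registered K1‴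
`UniversalToricDescentBetaRoadParamDefs.PrincipalHeegnerIndivisibleMultOfParamAtThree` with the fixed group
`κ.layerSubgroup k ⊓ decomp 𝔭` replaced by `κ.layerSubgroup k`: the trace `∑_{r∈R} r•x ∈ E′(K_k)` of a Heegner point of
conductor `3^{k+1}` is not `3`·(a `K_k`-rational point).  The binders `𝔭, …` are kept binder-for-binder (unused in the
conclusion).  TAG: WEAKER than K1‴ (`global_of_principalHeegnerIndivisible`); INSTRUMENTABLE per twin; class-wide = Cornut–Vatsal
mod `3` at `3 ∥ N′` (port, UNDECIDED). [cite: CornutVatsal2005, Thm. 1.10 (shape)] [cite: Matar2014, Thm. 1.2 (shape; `p ∤ N d_K`)] -/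
@[conjecture]
def GlobalHeegnerIndivisibleMultOfParamAtThree : Prop :=
    ∀ (W' : WeierstrassCurve ℚ) [W'.IsElliptic] [W'.IsGloballyMinimal] (N' : ℕ) [NeZero N']
      (K : Type) [Field K] [NumberField K] (_Dt' : ModularParametrizationData W' N'),
      Rank1Residual.Mult W' 3 → ¬ 3 ∣ padicValInt 3 W'.minimalDiscriminantInt →
      W'.HasSurjectiveModNGaloisRep 3 → W'.conductorNorm ℤ = N' → IsImaginaryQuadratic K →
      SatisfiesHeegnerHypothesis N' K → Odd (NumberField.discr K) →
      ∀ (κ : ZpExtension K 3), κ.IsAnticyclotomic →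
      ∀ (𝔭 : HeightOneSpectrum (𝓞 K)), ((3 : ℕ) : 𝓞 K) ∈ 𝔭.asIdeal →
        𝔭.asIdeal.ramificationIdx (𝓞 ℚ) = 1 → 𝔭.asIdeal.inertiaDeg (𝓞 ℚ) = 1 →
      ∃ (jbar : AlgebraicClosure K →+* ℂ) (Dt : ModularParametrizationData W' N') (β : ℤ)
        (_ : (4 * N' : ℤ) ∣ β ^ 2 - NumberField.discr K) (k : ℕ)
        (x : geomPoints (W'.baseChange K)) (R : Finset (absoluteGaloisGroup K)),
        complexPoint W' jbar x = heegnerPointComplexOfConductor Dt (NumberField.discr K) β (3 ^ (k + 1)) ∧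
        (↑R ⊆ (κ.layerSubgroup k : Set (absoluteGaloisGroup K))) ∧
        (∀ τ ∈ κ.layerSubgroup k, ∃! r, r ∈ R ∧ r⁻¹ * τ ∈ ringClassSubgroup K (3 ^ (k + 1)) jbar) ∧
        ∀ (P : geomPoints (W'.baseChange K)), (∀ σ ∈ κ.layerSubgroup k, σ • P = P) →
          (3 : ℤ) • P ≠ ∑ r ∈ R, r • x

/-- **FINE‴ — the `3`-torsion of the FINE Selmer group `Sel₀(K_∞, E′[3^∞])` is finite** (anticyclotomic Coates–Sujatha
Conjecture A/B for the twin at `p = 3`: `μ = 0` and cotorsion of the everywhere-strict Selmer group), with the crux's binders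
copied verbatim (both buckets; `γ, 𝔭, 𝔭′` unused in the conclusion, kept so that `fine_of_crux` is binder-for-binder).
TAG: WEAKER than the crux (`fine_of_crux`); INSTRUMENTABLE per twin by Wuthrich's Euler-characteristic formula from layer-0
data [cite: Matar2018, Thm. 4.1] [cite: Wuthrich2007JAG, Thm. 6.1] and by the tree's class-group
criterion `finite_fineSelmerInfty_of_equivariantHom_classGroup_layer_eq_zero`; class-wide IDEA-NEEDED.
[cite: Matar2018, Conj. B] [cite: CoatesSujatha2005, Conj. A] -/
@[conjecture]
def FineSelmerThreeTorsionFiniteAtThree : Prop :=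
    ∀ (W' : WeierstrassCurve ℚ) [W'.IsElliptic] [W'.IsGloballyMinimal] (N' : ℕ) [NeZero N']
      (K : Type) [Field K] [NumberField K] (_Dt' : ModularParametrizationData W' N'),
      (Rank1Residual.Mult W' 3 ∧ ¬ 3 ∣ padicValInt 3 W'.minimalDiscriminantInt ∨
        Rank1Residual.GoodSS W' 3 ∧ W'.frobeniusTrace 3 = 0) →
      W'.HasSurjectiveModNGaloisRep 3 → W'.conductorNorm ℤ = N' → IsImaginaryQuadratic K →
      SatisfiesHeegnerHypothesis N' K → Odd (NumberField.discr K) →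
      ∀ (κ : ZpExtension K 3), κ.IsAnticyclotomic →
      ∀ (γ : absoluteGaloisGroup K) [Fact (κ.IsTopGenerator γ)]
        (𝔭 : HeightOneSpectrum (𝓞 K)), ((3 : ℕ) : 𝓞 K) ∈ 𝔭.asIdeal →
        𝔭.asIdeal.ramificationIdx (𝓞 ℚ) = 1 → 𝔭.asIdeal.inertiaDeg (𝓞 ℚ) = 1 →
      ∀ (𝔭' : HeightOneSpectrum (𝓞 K)), ((3 : ℕ) : 𝓞 K) ∈ 𝔭'.asIdeal → 𝔭' ≠ 𝔭 →
      Set.Finite {s : (W'.baseChange K).fineSelmerInfty κ | (3 : ℕ) • s = 0}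

/-- **CUT‴ — the Matar cut at `3 ∥ N′` as a named implication**: (G)‴ ∧ FINE‴ ⟹ K1‴ (global indivisibility of one
principal layer Heegner point + finiteness of `Sel₀(K_∞, E′[3^∞])[3]` ⟹ LOCAL residual indivisibility at the degree-one
prime `𝔭`).  Port of the «backward implication» B ⟹ C(i) of [cite: Matar2018, Thm. 3.3(a), proof p. 12–14]
from a good ordinary `p ≥ 5` to `p = 3` multiplicative très ramifié.  TAG: UNDECIDED · ATTACKABLE (size L).
[cite: Gross1991, Prop. 5.3 (`τ` on Heegner points, shape)] -/
@[conjecture]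
def FineCutMultAtThree : Prop :=
    GlobalHeegnerIndivisibleMultOfParamAtThree → FineSelmerThreeTorsionFiniteAtThree →
      UniversalToricDescentBetaRoadParamDefs.PrincipalHeegnerIndivisibleMultOfParamAtThree

/-! ## §2 Evidence for the tags (no `sorry`) -/

/-- **K1‴ ⟹ (G)‴**: a point fixed by the whole layer group `Γ_k` is fixed by `Γ_k ∩ D_𝔭`; so local (at `𝔭`) residual
indivisibility implies global residual indivisibility.  (G)‴ is WEAKER than the registered K1‴.
[cite: Matar2018, §1 (C(i) ⟹ global non-divisibility, shape)] -/
theorem global_of_principalHeegnerIndivisible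
    (hK1 : UniversalToricDescentBetaRoadParamDefs.PrincipalHeegnerIndivisibleMultOfParamAtThree) :
    GlobalHeegnerIndivisibleMultOfParamAtThree := by
  intro W' _ _ N' _ K _ _ Dt' hm htr hsurj hN hK hH hodd κ hκ 𝔭 h𝔭 he hf
  obtain ⟨jbar, Dt, β, hβ, k, x, R, hx, hR, huniq, hind⟩ :=
    (UniversalToricDescentBetaRoadParamDefs.principalHeegnerIndivisibleMultOfParamAtThree_iff.mp hK1)
      W' N' K Dt' hm htr hsurj hN hK hH hodd κ hκ 𝔭 h𝔭 he hf
  exact ⟨jbar, Dt, β, hβ, k, x, R, hx, hR, huniq,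
    fun P hP ↦ hind P fun σ hσ ↦ hP σ (Subgroup.mem_inf.mp hσ).1⟩

/-- **`Sel₀(K_∞, E[p^∞]) ≤ Sel_𝔭^Σ(K_∞, E[p^∞])`** for any `𝔭 ∣ p` and any `Σ`: the fine (everywhere strict) Selmer group
of the tree lies inside Castella's Selmer group (strict at `𝔭`, relaxed at the other primes above `p`, trivial away from
`Σ ∪ {v ∣ p}`) — the fine local datum and Castella's strict datum at `𝔭` are the same datum `M⁺ = 0`.
[cite: Greenberg1989, §1 p. 98 ("strict")] [cite: Castella2018, Def. 2.2] -/
theorem fineSelmerInfty_le_selmerAc {K : Type} [Field K] [NumberField K] (W : WeierstrassCurve K) (p : ℕ)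
    [Fact p.Prime] (κ : ZpExtension K p) (𝔭 : HeightOneSpectrum (𝓞 K)) (h𝔭 : ((p : ℕ) : 𝓞 K) ∈ 𝔭.asIdeal)
    (S : Set (HeightOneSpectrum (𝓞 K))) :
    W.fineSelmerInfty κ ≤ selmerAc W p κ 𝔭 S := by
  intro c hc
  have hc' := (mem_strictSelmerGroupOver_iff c).mp hc
  exact (mem_selmerOver_iff c).mpr
    ⟨fun v hv _ σ ↦ hc'.1 v hv σ, hc'.2.1, fun σ ↦ hc'.2.2 𝔭 h𝔭 σ⟩

/-- Pure algebra: finiteness of the `n`-torsion passes from an additive subgroup to a smaller one.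
[folklore] -/
theorem finite_nsmul_eq_zero_of_le {A : Type*} [AddCommGroup A] {B C : AddSubgroup A} (hle : B ≤ C) (n : ℕ)
    (h : Set.Finite {s : C | n • s = 0}) : Set.Finite {s : B | n • s = 0} := by
  let ι : B → C := fun s ↦ ⟨s.1, hle s.2⟩
  have hι : Function.Injective ι := by
    intro a b hab
    apply Subtype.ext
    have h1 : ((ι a : C) : A) = ((ι b : C) : A) := congrArg Subtype.val hab
    exact h1
  refine Set.Finite.of_finite_image (h.subset ?_) hι.injOn
  rintro _ ⟨s, hs, rfl⟩
  have hs' : n • (s : A) = 0 := by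
    have h1 := congrArg Subtype.val hs
    simpa using h1
  show n • ι s = 0
  exact Subtype.ext (by simpa [ι] using hs')

/-- **crux ⟹ FINE‴** (so FINE‴ is a CONSEQUENCE of the crux, in both buckets): torsion of `X_(∅,0)` at `𝔭′` with a
norm-one coefficient of the characteristic series ⟹ `Sel_𝔭′(K_∞, E′[3^∞])[3]` finite (route receptacle) ⟹ the `3`-torsion
of the smaller fine Selmer group is finite. [cite: Washington1997, §13.2] [cite: Matar2018, Conj. B (shape)] -/
theorem fine_of_crux
    (h : Summit.BirchSwinnertonDyer.BirchSwinnertonDyer.Theses.UniversalToricDescent.TwinAlgMuZeroAtThree) :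
    FineSelmerThreeTorsionFiniteAtThree := by
  intro W' _ _ N' _ K _ _ Dt' hbucket hsurj hN hK hH hodd κ hκ γ _ 𝔭 h𝔭 he hf 𝔭' h𝔭' hne
  obtain ⟨htors, g, hg, hi⟩ := h W' N' K Dt' hbucket hsurj hN hK hH hodd κ hκ γ 𝔭 h𝔭 he hf 𝔭' h𝔭' hne
  have hfin := UniversalToricDescentAcDualMuZero.finite_pTorsion_of_isTorsion_of_exists_generator
    (W'.baseChange K) 3 κ 𝔭' ∅ γ Set.finite_empty htors ⟨g, hg, hi⟩
  exact finite_nsmul_eq_zero_of_le (fineSelmerInfty_le_selmerAc (W'.baseChange K) 3 κ 𝔭' h𝔭' ∅) 3 hfin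

/-- **The line of record already gives FINE‴**: K1‴ ∧ K2a‴ ∧ C₀′ ⟹ crux ⟹ FINE‴ (sanity: the node is a re-cut of K1‴, not a
strengthening of the stub set). [cite: Howard2004HeegnerKolyvagin, Thm. 2.3.1 (shape only)] -/
theorem fine_of_betaRoadParamStubs
    (hK1 : UniversalToricDescentBetaRoadParamDefs.PrincipalHeegnerIndivisibleMultOfParamAtThree)
    (hK2 : UniversalToricDescentKsTwinLambdaDefs.KsTwinLambdaAdicAtThree)
    (hC0 : UniversalToricDescentBetaRoadParamDefs.TwinAlgMuZeroAtThreeGoodSSOfParam) :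
    FineSelmerThreeTorsionFiniteAtThree :=
  fine_of_crux (UniversalToricDescentTwinAlgMuZeroAtThreeOfBetaRoadParam.twinAlgMuZeroAtThree_of_betaRoadParamStubs hK1 hK2 hC0)

/-! ## §3 The five stubs of the node (the ONLY `sorry`s of this file) -/

/-- **stub (G)‴** — GLOBAL indivisibility of one principal layer Heegner point, bucket B.  UNDECIDED · INSTRUMENTABLE
(per twin: reduction modulo one good prime of `K_k`) · class-wide: port of Cornut–Vatsal mod `3` to `3 ∥ N′`.
[cite: CornutVatsal2005, Thm. 1.10 (shape)] [cite: Matar2014, Thm. 1.2 (shape)] -/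
theorem stub_globalHeegnerIndivisible : GlobalHeegnerIndivisibleMultOfParamAtThree := by
  sorry

/-- **stub FINE‴** — anticyclotomic Coates–Sujatha at `p = 3` for the twin.  UNDECIDED · INSTRUMENTABLE (Wuthrich's
Euler characteristic from layer-0 data; class-group criterion of the tree) · class-wide IDEA-NEEDED.
[cite: Matar2018, Conj. B and Thm. 4.1] [cite: Wuthrich2007JAG, Thm. 6.1] [cite: CoatesSujatha2005, Conj. A] -/
theorem stub_fineSelmerTorsionFinite : FineSelmerThreeTorsionFiniteAtThree := by
  sorry

/-- **stub CUT** — the Matar cut ported to `3 ∥ N′`: global indivisibility of the Heegner module together with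
finiteness of `Sel₀(K_∞, E′[3^∞])[3]` forces LOCAL residual indivisibility at the degree-one prime `𝔭` (Kummer classes of
locally divisible Heegner points are fine classes killed by `3`; `E′(K_{∞,w})[3] = 0` for `w ∣ 3`, `E′(K_∞)[3] = 0`,
two-term norm relations with `a₃ = ±1`, `τ`-symmetry `𝔭 ↔ 𝔭′`).  UNDECIDED · ATTACKABLE; size L.
[cite: Matar2018, Thm. 3.3(a) proof, p. 12–14] [cite: Gross1991, Prop. 5.3 (`τ` on Heegner points)] -/
theorem stub_fineCut : FineCutMultAtThree := by
  sorry

/-- **stub K2a‴** (`KsTwinLambdaAdicAtThree`, item stmt-32864) BY NAME — unchanged from line `beta-road` v19.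
[cite: Howard2004HeegnerKolyvagin, Thm. 2.3.1 (shape)] -/
theorem stub_ksTwinLambda : UniversalToricDescentKsTwinLambdaDefs.KsTwinLambdaAdicAtThree := by
  sorry

/-- **stub C₀′** (`TwinAlgMuZeroAtThreeGoodSSOfParam`) BY NAME — unchanged from line `beta-road` v19.
[cite: Howard2004HeegnerKolyvagin, Thm. B (shape)] -/
theorem stub_goodSS : UniversalToricDescentBetaRoadParamDefs.TwinAlgMuZeroAtThreeGoodSSOfParam := by
  sorry

/-! ## §4 Composition: the crux BY NAME -/

/-- **Crux 24737 `TwinAlgMuZeroAtThree` BY NAME from the node's pieces**: (G)‴, FINE‴ and the cut give K1‴; then the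
registered v19 composition `twinAlgMuZeroAtThree_of_betaRoadParamStubs` with K2a‴ and C₀′.  No `sorry` here.
[cite: Matar2018, Thm. 3.3(a)] [cite: Howard2004HeegnerKolyvagin, Thm. 2.3.1, Thm. B] -/
theorem TwinAlgMuZeroAtThree_of
    (hG : GlobalHeegnerIndivisibleMultOfParamAtThree) (hF : FineSelmerThreeTorsionFiniteAtThree)
    (hcut : FineCutMultAtThree)
    (hK2 : UniversalToricDescentKsTwinLambdaDefs.KsTwinLambdaAdicAtThree)
    (hC0 : UniversalToricDescentBetaRoadParamDefs.TwinAlgMuZeroAtThreeGoodSSOfParam) :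
    Summit.BirchSwinnertonDyer.BirchSwinnertonDyer.Theses.UniversalToricDescent.TwinAlgMuZeroAtThree :=
  UniversalToricDescentTwinAlgMuZeroAtThreeOfBetaRoadParam.twinAlgMuZeroAtThree_of_betaRoadParamStubs
    (hcut hG hF) hK2 hC0

/-- **The node closes the crux from its five stubs** (inherits their `sorry`s). -/
theorem TwinAlgMuZeroAtThree_of_stubs :
    Summit.BirchSwinnertonDyer.BirchSwinnertonDyer.Theses.UniversalToricDescent.TwinAlgMuZeroAtThree :=
  TwinAlgMuZeroAtThree_of stub_globalHeegnerIndivisible stub_fineSelmerTorsionFinite stub_fineCut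
    stub_ksTwinLambda stub_goodSS

end Summit.BirchSwinnertonDyer.BirchSwinnertonDyer.Cruxes.TwinAlgMuZeroAtThree.FineSelmerCut

end
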